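import Summits.Ventures.CertifiedManyBodySolver.Transport.ChainWindowReflectionSign
import HarnessLib

/-!
# Ventures/CertifiedManyBodySolver — Transport/ChainWindowReflectionRows.lean

Speedrun cell sr-mbsolver — LIT team (lit-1 gen-7), LEAD r118 (c) "STAGE 3", part B2b (2 of 2): THE REFLECTION `W = P · V` ON THE
WINDOW `{-1, …, n+1}` — OBJECTIVE, ROWS, `W² = 1`, AND THE SECTOR SIGN.
HONEST FRAMING: first certified bounds; not a superconductivity verdict; every number certified or labelled float.

With `r = chainReflect (-1) (n+1)` (`x ↦ n − x`), `P = permOp r`, `V = ⨂_x diag(1,1,1,−1)` (part 1), `W = reflectPV n := P · V`: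
`W` maps the bond density of `(x_j, x_{j+1})` to that of `(x_{n+1−j}, x_{n+2−j})`, hence FIXES the bond average
`h_avg = tlmObjective t U n` (reindex `j ↦ n+1−j`) and the site average `n_avg = tlmDensity n`; every row of the ENT / `tl_marginal`
node `EntTLMChainNode` (positivity and trace by the generic lemmas of `ChainWindowSpinFlip`, LTI, sector zeros, density, reality,
entropy) survives `ρ ↦ WρWᴴ`; `Wᴴ = W`, `W² = 1` (so the midpoint `½(ρ + WρWᴴ)` is `W`-invariant); `W` commutes with the spin
flip `⨂u` (so spin-flip invariance survives the second averaging). Finally op-08's Fock unitary (`code/oplayer/fockspace.py`: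
`reflection`) is `reflectionOp n = S · W` with the sector sign `S = diag((−1)^{N(N−1)/2})` — the Jordan–Wigner sign of a reflected
occupation list is `(−1)^{#pairs on distinct sites} = (−1)^{N(N−1)/2}·(−1)^{#doubly occupied sites}` — and `S` acts trivially on
the sector-block-diagonal matrices of the node, so `reflectionOp`-invariance and `W`-invariance agree on the feasible set.
No sorry, no axiom; definitions with bodies: `reflectPV`, `chargeCount`, `reflectSign`, `reflectionOp`.
[cite: KullEtAl2024, §II.B, §VI.B] [cite: EsslerEtAl2005, §12.3.4 eqs. (12.196)–(12.201)] [cite: BratteliRobinsonII1997, §6.2.1]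
[cite: FawziFawziScalet2024Entropy, Theorem 4.1]
-/

noncomputable section

open Matrix Complex
open scoped ComplexOrder BigOperators
open Literature.Probability.LatticeModels
open Literature.MathematicalPhysics.QuantumLattice
open Literature.MathematicalPhysics.QuantumLattice.HubbardWave0
open Literature.MathematicalPhysics.QuantumLattice.JordanWigner
open Literature.InformationTheory.Entropy (vonNeumannEntropy)

namespace Summit.Ventures.CertifiedManyBodySolver.Transport

/-! ### §1 `W = reflectPV n` on the window `{-1, …, n+1}`: objective, density, rows, `W² = 1`, commutation with the spin flip -/

section Rows

variable (n : ℕ)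

/-- **The sign-free part `W = P · V` of the reflection unitary** of the window `{-1, …, n+1}`. [cite: EsslerEtAl2005, §12.3.4] -/
def reflectPV (n : ℕ) : Op (PolySite (chainWindow (-1) ((n : ℤ) + 1))) 4 :=
  permOp (chainReflect (-1) ((n : ℤ) + 1)) * productOp (fun _ => uDouble)

/-- `r x_j = x_{n+2−j}` (`x_j = j − 1`). [folklore] -/
theorem chainReflect_pt_tlmSite {j j' : ℕ} (hj : j ≤ n + 2) (hj' : j' ≤ n + 2) (hjj : j + j' = n + 2) :
    chainReflect (-1) ((n : ℤ) + 1) (PolySite.pt (tlmSite j) (tlmSite_mem hj)) = PolySite.pt (tlmSite j') (tlmSite_mem hj') := by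
  refine polySite_eq_of_coord_eq ?_
  rw [chainReflect_apply_zero, PolySite.ofLex_coe_pt, PolySite.ofLex_coe_pt]
  simp only [tlmSite]
  omega

/-- `j + rev j + 1 = m` in `Fin m`. [folklore] -/
theorem fin_val_add_rev (m : ℕ) (j : Fin m) : (j : ℕ) + ((Fin.rev j : ℕ) + 1) = m := by
  have h1 := Fin.val_rev j
  have h2 := j.isLt
  omega

/-- **`h_avg` is reflection invariant**: `W · toSpin (tlmObjective t U n) · Wᴴ = toSpin (tlmObjective t U n)` (bond `j ↦ n+1−j`).
[cite: KullEtAl2024, §II.B, §VI.B] -/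
theorem reflectPV_conj_toSpin_tlmObjective (t U : ℝ) :
    reflectPV n * toSpin (tlmObjective t U n) * (reflectPV n)ᴴ = toSpin (tlmObjective t U n) := by
  rw [reflectPV, tlmObjective, map_smul, map_sum, conj_smul, conj_sum]
  congr 1
  refine Fintype.sum_equiv Fin.revPerm _ _ fun j => ?_
  rw [Fin.revPerm_apply]
  have hj : (j : ℕ) + ((Fin.rev j : ℕ) + 1) = n + 2 := fin_val_add_rev (n + 2) j
  exact reflW_conj_toSpin_tlmBond t U _ _ _ _ _ (tlmSite_succ_apply j) (tlmSite_succ_apply _)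
    (chainReflect_pt_tlmSite n (by omega) (by omega) hj) (chainReflect_pt_tlmSite n (by omega) (by omega) (by omega))

/-- **`n_avg` is reflection invariant.** [cite: KullEtAl2024, §II.B] -/
theorem reflectPV_conj_toSpin_tlmDensity : reflectPV n * toSpin (tlmDensity n) * (reflectPV n)ᴴ = toSpin (tlmDensity n) := by
  rw [reflectPV, mul_conj_eq]
  have hV : productOp (fun _ => uDouble) * toSpin (tlmDensity n) * (productOp (fun _ => uDouble))ᴴ = toSpin (tlmDensity n) := by
    rw [tlmDensity, map_smul, map_sum, conj_smul, conj_sum]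
    congr 1
    refine Finset.sum_congr rfl fun p _ => ?_
    rw [map_sum, conj_sum]
    refine Finset.sum_congr rfl fun σ _ => ?_
    rw [toSpin_numberOp, productOp_conj_onSite (fun _ => by rw [uDouble_conjTranspose, uDouble_mul_self]), uDouble_conj_siteNumber]
  rw [hV, reflect_conj_toSpin_tlmDensity]

/-- `Wᴴ = W`. [folklore] -/
theorem reflectPV_conjTranspose : (reflectPV n)ᴴ = reflectPV n := by
  rw [reflectPV, Matrix.conjTranspose_mul, dbl_conjTranspose, conjTranspose_permOp, chainReflect_symm, permOp_mul_productOp_const]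

/-- **`W² = 1`.** [folklore] -/
theorem reflectPV_mul_self : reflectPV n * reflectPV n = 1 := by
  rw [reflectPV, permOp_mul_productOp_const,
    show productOp (fun _ => uDouble) * permOp (chainReflect (-1) ((n : ℤ) + 1)) *
        (productOp (fun _ => uDouble) * permOp (chainReflect (-1) ((n : ℤ) + 1))) =
      productOp (fun _ => uDouble) * (permOp (chainReflect (-1) ((n : ℤ) + 1)) * productOp (fun _ => uDouble)) *
        permOp (chainReflect (-1) ((n : ℤ) + 1)) by simp only [Matrix.mul_assoc],
    permOp_mul_productOp_const, ← Matrix.mul_assoc, dbl_mul_self, Matrix.one_mul,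
    permOp_mul_self_of_symm_eq _ (chainReflect_symm _ _)]

/-- `Wᴴ W = 1`. [folklore] -/
theorem reflectPV_conjTranspose_mul_self : (reflectPV n)ᴴ * reflectPV n = 1 := by
  rw [reflectPV_conjTranspose, reflectPV_mul_self]

/-- **`W² ρ W²ᴴ = ρ`** (so the midpoint `½(ρ + WρWᴴ)` is `W`-invariant, `conj_midpoint_self`). [folklore] -/
theorem reflectPV_sq_conj (ρ : Op (PolySite (chainWindow (-1) ((n : ℤ) + 1))) 4) :
    (reflectPV n * reflectPV n) * ρ * (reflectPV n * reflectPV n)ᴴ = ρ := by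
  rw [reflectPV_mul_self, Matrix.conjTranspose_one, Matrix.one_mul, Matrix.mul_one]

/-- **The spin flip commutes with `W`.** [folklore] -/
theorem spinFlip_mul_reflectPV :
    productOp (fun _ => uSpinFlip) * reflectPV n = (1 : ℂ) • (reflectPV n * productOp (fun _ => uSpinFlip)) := by
  rw [one_smul, reflectPV, ← Matrix.mul_assoc, ← permOp_mul_productOp_const, Matrix.mul_assoc, productOp_mul, Matrix.mul_assoc,
    productOp_mul]
  simp only [uSpinFlip_mul_uDouble]

/-- **The objective is reflection invariant.** [cite: KullEtAl2024, §II.B] -/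
theorem reflectPV_objective (t U : ℝ) (ρ : Op (PolySite (chainWindow (-1) ((n : ℤ) + 1))) 4) :
    ((toSpin (tlmObjective t U n) * (reflectPV n * ρ * (reflectPV n)ᴴ)).trace).re = ((toSpin (tlmObjective t U n) * ρ).trace).re := by
  rw [trace_mul_conj_of_invariant
    (conjTranspose_conj_of_conj (reflectPV_conjTranspose_mul_self n) (reflectPV_conj_toSpin_tlmObjective n t U))]

/-- **The density row survives the reflection.** [cite: KullEtAl2024, §II.B] -/
theorem reflectPV_densityRow {ρ : Op (PolySite (chainWindow (-1) ((n : ℤ) + 1))) 4} {ν : ℝ}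
    (hdens : ((toSpin (tlmDensity n) * ρ).trace).re = ν) :
    ((toSpin (tlmDensity n) * (reflectPV n * ρ * (reflectPV n)ᴴ)).trace).re = ν := by
  rw [trace_mul_conj_of_invariant
    (conjTranspose_conj_of_conj (reflectPV_conjTranspose_mul_self n) (reflectPV_conj_toSpin_tlmDensity n)), hdens]

/-- **The LTI row survives the reflection** (`V` is a constant product unitary, then part B2a for `P`). [cite: KullEtAl2024, §II.B eq. (locTIn)] -/
theorem reflectPV_ltiRow {ρ : Op (PolySite (chainWindow (-1) ((n : ℤ) + 1))) 4}
    (hLTI : spinPartialTrace ((PolySite.affEmb 1 (unitVec 0) (chainWindow (-1) (n : ℤ))).trans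
        (PolySite.incl (affShiftSet_chainWindow_subset (-1) (n : ℤ)))) ρ =
      spinPartialTrace (PolySite.incl (chainWindow_mono_right (-1) (by omega : (n : ℤ) ≤ n + 1))) ρ) :
    spinPartialTrace ((PolySite.affEmb 1 (unitVec 0) (chainWindow (-1) (n : ℤ))).trans
        (PolySite.incl (affShiftSet_chainWindow_subset (-1) (n : ℤ)))) (reflectPV n * ρ * (reflectPV n)ᴴ) =
      spinPartialTrace (PolySite.incl (chainWindow_mono_right (-1) (by omega : (n : ℤ) ≤ n + 1)))
        (reflectPV n * ρ * (reflectPV n)ᴴ) := by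
  rw [reflectPV, mul_conj_eq]
  refine reflect_ltiRow n ?_
  rw [spinPartialTrace_productOp_conj _ (fun _ => uDouble_mem_unitaryGroup) ρ,
    spinPartialTrace_productOp_conj _ (fun _ => uDouble_mem_unitaryGroup) ρ, hLTI]

/-- **Sector zeros survive the reflection.** [folklore] -/
theorem reflectPV_sectorRow {ρ : Op (PolySite (chainWindow (-1) ((n : ℤ) + 1))) 4}
    (hρ : ∀ σ : Fin 2, ∀ k k',
      (∑ x, if σ ∈ siteOcc (k x) then 1 else 0 : ℕ) ≠ (∑ x, if σ ∈ siteOcc (k' x) then 1 else 0 : ℕ) → ρ k k' = 0)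
    (σ : Fin 2) (k k' : TensorIndex (PolySite (chainWindow (-1) ((n : ℤ) + 1))) 4)
    (hk : (∑ x, if σ ∈ siteOcc (k x) then 1 else 0 : ℕ) ≠ (∑ x, if σ ∈ siteOcc (k' x) then 1 else 0 : ℕ)) :
    (reflectPV n * ρ * (reflectPV n)ᴴ) k k' = 0 := by
  rw [reflectPV, mul_conj_eq]
  exact permOp_sectorRow _ (fun τ l l' hl => dbl_sectorRow hρ τ l l' hl) σ k k' hk

/-- **Real entries survive the reflection.** [folklore] -/
theorem reflectPV_realRow {ρ : Op (PolySite (chainWindow (-1) ((n : ℤ) + 1))) 4} (hρ : ∀ k k', starRingEnd ℂ (ρ k k') = ρ k k')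
    (k k' : TensorIndex (PolySite (chainWindow (-1) ((n : ℤ) + 1))) 4) :
    starRingEnd ℂ ((reflectPV n * ρ * (reflectPV n)ᴴ) k k') = (reflectPV n * ρ * (reflectPV n)ᴴ) k k' := by
  rw [reflectPV, mul_conj_eq]
  exact permOp_realRow _ (fun l l' => dbl_realRow hρ l l') k k'

/-- **The entropy row survives the reflection** (given the LTI row). [cite: FawziFawziScalet2024Entropy, Theorem 4.1] -/
theorem reflectPV_entropyRow {ρ : Op (PolySite (chainWindow (-1) ((n : ℤ) + 1))) 4} (hρ : ρ.PosSemidef)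
    (hLTI : spinPartialTrace ((PolySite.affEmb 1 (unitVec 0) (chainWindow (-1) (n : ℤ))).trans
        (PolySite.incl (affShiftSet_chainWindow_subset (-1) (n : ℤ)))) ρ =
      spinPartialTrace (PolySite.incl (chainWindow_mono_right (-1) (by omega : (n : ℤ) ≤ n + 1))) ρ)
    (hent : 0 ≤ vonNeumannEntropy ρ -
      vonNeumannEntropy (spinPartialTrace (PolySite.incl (chainWindow_mono_right (-1) (by omega : (n : ℤ) ≤ n + 1))) ρ)) :
    0 ≤ vonNeumannEntropy (reflectPV n * ρ * (reflectPV n)ᴴ) -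
      vonNeumannEntropy (spinPartialTrace (PolySite.incl (chainWindow_mono_right (-1) (by omega : (n : ℤ) ≤ n + 1)))
        (reflectPV n * ρ * (reflectPV n)ᴴ)) := by
  have hH : (productOp (fun _ => uDouble) * ρ * (productOp (fun _ => uDouble))ᴴ).IsHermitian :=
    (hρ.mul_mul_conjTranspose_same (productOp (fun _ => uDouble))).1
  have hL : spinPartialTrace ((PolySite.affEmb 1 (unitVec 0) (chainWindow (-1) (n : ℤ))).trans
        (PolySite.incl (affShiftSet_chainWindow_subset (-1) (n : ℤ))))
        (productOp (fun _ => uDouble) * ρ * (productOp (fun _ => uDouble))ᴴ) =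
      spinPartialTrace (PolySite.incl (chainWindow_mono_right (-1) (by omega : (n : ℤ) ≤ n + 1)))
        (productOp (fun _ => uDouble) * ρ * (productOp (fun _ => uDouble))ᴴ) := by
    rw [spinPartialTrace_productOp_conj _ (fun _ => uDouble_mem_unitaryGroup) ρ,
      spinPartialTrace_productOp_conj _ (fun _ => uDouble_mem_unitaryGroup) ρ, hLTI]
  rw [reflectPV, mul_conj_eq, reflect_entropyRow n hH hL,
    entropy_sub_spinPartialTrace_productOp_conj _ (fun _ => uDouble_mem_unitaryGroup) hρ.1]
  exact hent

end Rows

/-! ### §2 The sector sign `S` and fockspace's `reflection = S · W` -/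

section Sign

variable {Y : Type} [Fintype Y] [DecidableEq Y]

/-- The particle number `N(k) = N_↑(k) + N_↓(k)` of a configuration, written with the node's sector counts. [folklore] -/
def chargeCount (k : TensorIndex Y 4) : ℕ :=
  (∑ x, if (0 : Fin 2) ∈ siteOcc (k x) then 1 else 0) + ∑ x, if (1 : Fin 2) ∈ siteOcc (k x) then 1 else 0

/-- **The sector sign** `S = diag((−1)^{N(N−1)/2})` (the Jordan–Wigner sign of reversing `N` singly-placed particles).
[cite: EsslerEtAl2005, §12.3.4 eqs. (12.196)–(12.201)] -/
def reflectSign : Op Y 4 := Matrix.diagonal fun k => (-1 : ℂ) ^ Nat.choose (chargeCount k) 2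

/-- **fockspace's `reflection`** of the window `{-1, …, n+1}` in the occupation basis: `S · P · V`. [cite: EsslerEtAl2005, §12.3.4] -/
def reflectionOp (n : ℕ) : Op (PolySite (chainWindow (-1) ((n : ℤ) + 1))) 4 := reflectSign * reflectPV n

/-- **`S` acts trivially on sector-block-diagonal matrices**: `S ρ Sᴴ = ρ` when `ρ_{kk'} = 0` unless `N_σ(k) = N_σ(k')` for both `σ`. [folklore] -/
theorem reflectSign_conj_of_sectorRow {ρ : Op Y 4}
    (hρ : ∀ σ : Fin 2, ∀ k k' : TensorIndex Y 4,
      (∑ x, if σ ∈ siteOcc (k x) then 1 else 0 : ℕ) ≠ (∑ x, if σ ∈ siteOcc (k' x) then 1 else 0 : ℕ) → ρ k k' = 0) :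
    reflectSign * ρ * reflectSignᴴ = ρ := by
  ext k k'
  rw [reflectSign, Matrix.diagonal_conjTranspose, Matrix.mul_diagonal, Matrix.diagonal_mul]
  by_cases h0 : (∑ x, if (0 : Fin 2) ∈ siteOcc (k x) then 1 else 0 : ℕ) = ∑ x, if (0 : Fin 2) ∈ siteOcc (k' x) then 1 else 0
  · by_cases h1 : (∑ x, if (1 : Fin 2) ∈ siteOcc (k x) then 1 else 0 : ℕ) = ∑ x, if (1 : Fin 2) ∈ siteOcc (k' x) then 1 else 0
    · have hN : chargeCount k = chargeCount k' := by rw [chargeCount, chargeCount, h0, h1]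
      rw [hN, Pi.star_apply, star_pow, star_neg, star_one, mul_assoc, mul_comm (ρ k k'), ← mul_assoc, ← mul_pow, neg_one_mul,
        neg_neg, one_pow, one_mul]
    · rw [hρ 1 k k' h1, mul_zero, zero_mul]
  · rw [hρ 0 k k' h0, mul_zero, zero_mul]

/-- `reflectionOp ρ reflectionOpᴴ = S (WρWᴴ) Sᴴ`. [folklore] -/
theorem reflectionOp_conj (n : ℕ) (ρ : Op (PolySite (chainWindow (-1) ((n : ℤ) + 1))) 4) :
    reflectionOp n * ρ * (reflectionOp n)ᴴ = reflectSign * (reflectPV n * ρ * (reflectPV n)ᴴ) * reflectSignᴴ := by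
  rw [reflectionOp, mul_conj_eq]

/-- **On the node's feasible set, `reflectionOp`-conjugation is `W`-conjugation.** [folklore] -/
theorem reflectionOp_conj_of_sectorRow (n : ℕ) {ρ : Op (PolySite (chainWindow (-1) ((n : ℤ) + 1))) 4}
    (hρ : ∀ σ : Fin 2, ∀ k k',
      (∑ x, if σ ∈ siteOcc (k x) then 1 else 0 : ℕ) ≠ (∑ x, if σ ∈ siteOcc (k' x) then 1 else 0 : ℕ) → ρ k k' = 0) :
    reflectionOp n * ρ * (reflectionOp n)ᴴ = reflectPV n * ρ * (reflectPV n)ᴴ := by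
  rw [reflectionOp_conj]
  exact reflectSign_conj_of_sectorRow fun σ k k' hk => reflectPV_sectorRow n hρ σ k k' hk

end Sign

end Summit.Ventures.CertifiedManyBodySolver.Transport
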